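import Literature.AlgebraicGeometry.Frobenioids.ArchimedeanTheoremsInstances
import Literature.AlgebraicGeometry.Frobenioids.ArchimedeanUnitStabilizers
import HarnessLib

/-!
# Frobenioids II, Theorem 3.6 (iii): the radial-scalar predicate `ArchFrd.radial π A f` — kernel
# witnesses for the FACT-LIST row F-1302

Mochizuki, *The geometry of Frobenioids II: poly-Frobenioids*, Kyushu J. Math. **62** (2008) 401–460,
§3, Theorem 3.6 (iii) p. 37 ("`β ∈ O^▷(A) ⊆ Φ^fld(A)` belongs to the submonoid `Φ^gp(A) × {1} ⊆ Φ^fld(A)`")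
and Definition 3.1 (ii) p. 23 (the canonical decomposition `O_K^× × ord(K^×) ⥲ K^×`, `ord(K^×) ≅ ℝ_{>0}`)
[cite: MochizukiFrdII2008, Thm 3.6 (iii) p.37].

PROOF-ONLY companion of `ArchimedeanTheoremsInstances.lean` (statement owner abc-iut-L1-t9); nothing is
defined, no statement of the paper is retyped.  abc-iut cell, block F (fact-proving wave), seat
abc-iut-f-007 (tranche 15 taken under the float rule), FACT-LIST row **F-1302** `ArchFrd.radial`.

The row names `ArchFrd.radial π A f := Im(scalar f) = 0 ∧ 0 < Re(scalar f)` — the DEFINITION of "the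
endomorphism `f` of `A ∈ Ob(C)` has positive real scalar" (the factor `ord(K^×) ≅ ℝ_{>0}` of the canonical
decomposition), i.e. VOCABULARY: the parameter `radial` of abc-iut-L1-t9's `Thm36iii_factorization`,
instantiated in `Thm36iii_factorization_C` (PROVED: `ArchFrd.thm36iii_factorization_C`,
`ArchimedeanIsometrization.lean`, FACT-LIST F-0875 ✓); `kernel_closedness = parametrised`.  What the
kernel can say about the bare predicate is recorded here (the `radialO` twin is F-2634,
`ArchimedeanCharSplittingRadialWitness.lean`, seat f-009):
* it is INHABITED: the identity of every object is radial (`radial_id`, scalar `1`);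
* its universal closure "every endomorphism of every object of `C`, over every base, has positive real
  scalar" is FALSE (`not_forall_radial`): over the printed base `D := D₀`, `π := 𝟭 D₀`, the unit
  `((id, 1, −1), id) ∈ O^×(A)` of the real unit object `A = ((Spec ℝ, [0, 1]), Spec ℝ)` (abc-iut's
  `ArchFrd.UnitStab.negAutOver`, the element of order two of Thm. 3.6 (v)) has scalar `−1` (`not_radial_negAutOver`).
So the row is admissible only as vocabulary / at its positive instances (R5).  typed ≠ proved for anything
not in this file; nothing here bears on [IUTchIII] Cor. 3.12.
-/

namespace Literature.AlgebraicGeometry.Frobenioids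

open CategoryTheory

noncomputable section

namespace ArchFrd

universe v u

variable {D : Type u} [Category.{v} D] (π : D ⥤ D0)

/-- The identity of an object of `C` is radial: its scalar is `1`. [cite: MochizukiFrdII2008, Thm 3.6 (iii) p.37] -/
theorem radial_id (A : C π) : radial π A (𝟙 A) := by
  change ((C0.scalar (𝟙 A.fst) : ℂˣ) : ℂ).im = 0 ∧ 0 < ((C0.scalar (𝟙 A.fst) : ℂˣ) : ℂ).re
  rw [C0.scalar_id']
  exact ⟨Complex.one_im, by rw [Units.val_one, Complex.one_re]; exact one_pos⟩

/-- The unit `((id, 1, −1), id)` of an object of `C` with naively isotropic region is NOT radial: its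
scalar is `−1`. [cite: MochizukiFrdII2008, Thm 3.6 (v) p.37] -/
theorem not_radial_negAutOver (X : C π) (hX : X.fst.IsNaivelyIsotropic) :
    ¬ radial π X (UnitStab.negAutOver π X hX).hom := by
  rintro ⟨-, h⟩
  have hs : ((C0.scalar (UnitStab.negAutOver π X hX).hom.fst : ℂˣ) : ℂ) = -1 := by
    rw [UnitStab.scalar_negAutOver, Units.val_neg, Units.val_one]
  rw [hs, Complex.neg_re, Complex.one_re] at h
  linarith

/-- **FACT-LIST F-1302**: the universal closure of `ArchFrd.radial` — "every endomorphism of every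
object of `C = C₀ ×_{D₀} D`, over every base, has positive real scalar" — is FALSE: over the printed base
`D := D₀`, `π := 𝟭 D₀`, the unit `((id, 1, −1), id)` of the real unit object `((Spec ℝ, [0, 1]), Spec ℝ)`
has scalar `−1`.  (`radial` is vocabulary, the parameter of `Thm36iii_factorization`; its positive
instances are `radial_id` and the radial factor of `thm36iii_factorization_C`.)
[cite: MochizukiFrdII2008, Thm 3.6 (iii) p.37] -/
theorem not_forall_radial :
    ¬ ∀ {D : Type} [Category.{0} D] (π : D ⥤ D0) (A : C π) (f : A ⟶ A),
      Literature.AlgebraicGeometry.Frobenioids.ArchFrd.radial π A f := by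
  intro h
  let X : C (𝟭 D0) := ⟨C0.realOfTip 1, D0.real, Iso.refl _⟩
  have hX : X.fst.IsNaivelyIsotropic := C0.isNaivelyIsotropic_of_isRealObj rfl
  exact not_radial_negAutOver (𝟭 D0) X hX (h (𝟭 D0) X _)

end ArchFrd

end

end Literature.AlgebraicGeometry.Frobenioids
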